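import Literature.NumberTheory.LFunctions.Zhang2022.Section3Lemma31
import HarnessLib

/-!
# The smoothed logarithmic second moment of `ν = 1 ∗ χ`: the remainder of the explicit formula on the line `re z = −9/20`

Topic `Literature/NumberTheory/LFunctions`. Everything here is PROVED.

For a primitive quadratic Dirichlet character `χ` mod `q` and `0 < A ≤ B`, the tree's explicit formula
(`DivisorSumCharSq.explicit_formula`, file `DivisorSumCharSqSmoothedMoment.lean`, the Mellin skeleton
of Zhang 2022 §3 / Conrey–Iwaniec 2002 (6.47)–(6.48)) reads
`W_{ν²}(B) − W_{ν²}(A) = g(0)(W_d(B) − W_d(A)) + (log B − log A) g′(0) + (1/2π)∫ N(−1/4+iy)/(−1/4+iy) dy`.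
Here we move the line to `re z = −9/20` (no pole of `N(z)/z` in `−1/2 < re z < 0`) and bound the
integral there by the Pólya–Vinogradov-strength estimate `|L(11/20+it,χ)| ≪ (√q log q)^{19/40}|s|`
(tree `DirichletAbel.norm_LFunction_le_rpow_polyaVinogradov`), `|ζ₁| ≪ (1+|t|)²`, `|Γ| ≪ (1+|t|)³e^{-π|t|/2}`,
`|φ(w)| ≤ 11·4^{ω(q)} ≤ 11 d(q)²` on `re w ≥ 11/20`, and `|B^z − A^z| ≤ 2A^{-9/20}`, obtaining

  `‖(W_{ν²}(B) − W_{ν²}(A)) − g(0)(W_d(B) − W_d(A)) − (log B − log A) g′(0)‖ ≤ C √q A^{-9/20}`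

for `1 ≤ A ≤ B`, `q > 4` (`explicit_formula_remainder_le`; the loss `q^{1/40}` between `q^{19/40}` and
`√q` absorbs `d(q)² (1 + log q)`). This is the remainder term of Conrey–Iwaniec's (6.48) in the form
the tree can prove (the printed `O((q/X)^{1/2})` needs `R_K(½+it) ≪ q^{1/2}|s|^{5/6}`); it is stub S3 of
SKELETON I6c (line `smoothed-mellin-large`, cell landau-siegel/ls-inputs).

«The programme SEARCHES and TYPES; no claim about Landau–Siegel zeros, Theorems 1–2 of
arXiv:2211.02515 or a repaired Margin232 until a kernel theorem says so.»

## References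
* [ConreyIwaniec2002] B. Conrey, H. Iwaniec, Acta Arith. 103 (2002) 259–312, §6 (6.43)–(6.48).
* [Zhang2022LandauSiegel] Y. Zhang, arXiv:2211.02515, §3, proof of Lemma 3.1 (Mellin skeleton only).
* [MontgomeryVaughan2007] H. L. Montgomery, R. C. Vaughan, *Multiplicative Number Theory I*, §9.4
  Thm 9.18 (Pólya–Vinogradov).
-/

noncomputable section

open Complex Filter Topology Set MeasureTheory Real Metric

namespace Literature.NumberTheory.LFunctions.DivisorSumCharSq

open Literature.NumberTheory.LFunctions.ZetaM4 (dCoeff CΓ CΓ_pos norm_Gamma_strip_le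
  integrable_pow_mul_exp integral_pow_mul_exp_le exists_pow_mul_exp_le)
open Literature.NumberTheory.LFunctions.HuxleyZeroDetection (integral_vertical_sub_eq_of_pole)
open Literature.NumberTheory.LFunctions.Zhang2022.Lemma31 (tsum_succ_rpow_neg_one_add_inv_le
  ne_one_of_isPrimitive norm_phi_one_add_le)

/-! ### §1. `φ` on `re w ≥ 11/20` -/

section PhiDeep

/-- `2^{-11/20} ≤ 3/4` (since `(2^{-11/20})^{20} = 2^{-11} < (3/4)^{20}`). [folklore] -/
private theorem two_rpow_neg_eleven_twentieths_le : (2 : ℝ) ^ (-(11 / 20 : ℝ)) ≤ 3 / 4 := by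
  have h20 : ((2 : ℝ) ^ (-(11 / 20 : ℝ))) ^ 20 = ((2 : ℝ) ^ 11)⁻¹ := by
    rw [← Real.rpow_natCast, ← Real.rpow_mul (by norm_num)]
    norm_num [Real.rpow_neg, Real.rpow_natCast]
  have hpos : 0 ≤ (2 : ℝ) ^ (-(11 / 20 : ℝ)) := Real.rpow_nonneg (by norm_num) _
  by_contra h
  push Not at h
  have : ((3 : ℝ) / 4) ^ 20 < ((2 : ℝ) ^ (-(11 / 20 : ℝ))) ^ 20 :=
    pow_lt_pow_left₀ h (by norm_num) (by norm_num)
  rw [h20] at this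
  norm_num at this

/-- **`|φ(w)| ≤ 11 · 4^{ω(N)}` for `re w ≥ 11/20`**: `‖ζ(2w)^{-1}‖ ≤ σ/(σ−1) ≤ 11` for `σ = re 2w ≥ 11/10`,
and every Euler factor has `‖1 + p^{-w}‖ ≥ 1 − 2^{-11/20} ≥ 1/4`. [cite: Zhang2022LandauSiegel, §3 (3.3)] -/
theorem norm_phi_le_deep {N : ℕ} {w : ℂ} (hw : 11 / 20 ≤ w.re) :
    ‖phi N w‖ ≤ 11 * (4 : ℝ) ^ N.primeFactors.card := by
  have h2re : (2 * w : ℂ).re = 2 * w.re := by simp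
  have h2 : 1 < (2 * w : ℂ).re := by rw [h2re]; linarith
  have hζ : ‖(riemannZeta (2 * w))⁻¹‖ ≤ 11 := by
    refine (ZetaClassicalRegion.norm_inv_riemannZeta_le_of_one_lt_re h2).trans ?_
    rw [div_le_iff₀ (by linarith), h2re]
    linarith
  have hprod : ((1 : ℝ) / 4) ^ N.primeFactors.card ≤ ‖∏ p ∈ N.primeFactors, (1 + (p : ℂ) ^ (-w))‖ := by
    rw [norm_prod, ← Finset.prod_const]
    refine Finset.prod_le_prod (fun _ _ => by norm_num) fun p hp => ?_
    have hp := Nat.prime_of_mem_primeFactors hp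
    have hpw : ‖(p : ℂ) ^ (-w)‖ ≤ (2 : ℝ) ^ (-(11 / 20 : ℝ)) := by
      rw [norm_natCast_cpow_of_pos hp.pos, neg_re]
      calc (p : ℝ) ^ (-w.re) ≤ (2 : ℝ) ^ (-w.re) :=
            Real.rpow_le_rpow_of_nonpos (by norm_num) (by exact_mod_cast hp.two_le) (by linarith)
        _ ≤ (2 : ℝ) ^ (-(11 / 20 : ℝ)) :=
            Real.rpow_le_rpow_of_exponent_le (by norm_num) (by linarith)
    have h34 := two_rpow_neg_eleven_twentieths_le
    calc (1 : ℝ) / 4 ≤ 1 - ‖(p : ℂ) ^ (-w)‖ := by linarith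
      _ ≤ ‖1 + (p : ℂ) ^ (-w)‖ := by
          have := norm_sub_norm_le (1 : ℂ) (-(p : ℂ) ^ (-w))
          rw [norm_one, norm_neg, sub_neg_eq_add] at this
          linarith
  have hprodpos : 0 < ((1 : ℝ) / 4) ^ N.primeFactors.card := pow_pos (by norm_num) _
  rw [phi, mul_inv, norm_mul]
  have hinv : ‖(∏ p ∈ N.primeFactors, (1 + (p : ℂ) ^ (-w)))⁻¹‖ ≤ (4 : ℝ) ^ N.primeFactors.card := by
    rw [norm_inv]
    calc ‖∏ p ∈ N.primeFactors, (1 + (p : ℂ) ^ (-w))‖⁻¹ ≤ (((1 : ℝ) / 4) ^ N.primeFactors.card)⁻¹ :=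
          inv_anti₀ hprodpos hprod
      _ = (4 : ℝ) ^ N.primeFactors.card := by rw [← inv_pow]; norm_num
  exact mul_le_mul hζ hinv (norm_nonneg _) (by norm_num)

/-- `4^{ω(N)} ≤ d(N)²` (`2^{ω(N)} ≤ d(N)`). [folklore] -/
private theorem four_pow_card_primeFactors_le {N : ℕ} (hN : N ≠ 0) :
    (4 : ℝ) ^ N.primeFactors.card ≤ (N.divisors.card : ℝ) ^ 2 := by
  have h2 : 2 ^ N.primeFactors.card ≤ N.divisors.card := by
    rw [Nat.card_divisors hN]
    refine Finset.pow_card_le_prod _ _ _ fun p hp => ?_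
    have hp := Nat.mem_primeFactors.mp hp
    have hpos : 0 < N.factorization p := hp.1.factorization_pos_of_dvd hN hp.2.1
    omega
  have h2' : (2 : ℝ) ^ N.primeFactors.card ≤ (N.divisors.card : ℝ) := by exact_mod_cast h2
  calc (4 : ℝ) ^ N.primeFactors.card = ((2 : ℝ) ^ N.primeFactors.card) ^ 2 := by
        rw [← pow_mul, mul_comm, pow_mul]; norm_num
    _ ≤ (N.divisors.card : ℝ) ^ 2 := by gcongr

/-- **`|φ(w)| ≤ 11 d(N)²` for `re w ≥ 11/20`**, `N ≥ 1`. [cite: Zhang2022LandauSiegel, §3 (3.3)] -/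
theorem norm_phi_le_deep' {N : ℕ} (hN : N ≠ 0) {w : ℂ} (hw : 11 / 20 ≤ w.re) :
    ‖phi N w‖ ≤ 11 * (N.divisors.card : ℝ) ^ 2 :=
  (norm_phi_le_deep hw).trans (by gcongr; exact four_pow_card_primeFactors_le hN)

end PhiDeep

/-! ### §2. `L(s, χ)` and `g` on `re ≥ 11/20` at Pólya–Vinogradov strength -/

section GDeep

variable {D : ℕ} [NeZero D] (χ : DirichletCharacter ℂ D)

/-- The `D`-factor of the strip bound: `P_D = (√D (1 + log D))^{19/40}`. [folklore] -/
def pvFac (D : ℕ) : ℝ := (Real.sqrt D * (1 + Real.log D)) ^ (19 / 40 : ℝ)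

omit [NeZero D] in
/-- `P_D ≥ 1` for `D ≥ 1`. [folklore] -/
private theorem one_le_pvFac (hD : 1 ≤ D) : 1 ≤ pvFac D := by
  unfold pvFac
  have h1 : (1 : ℝ) ≤ D := by exact_mod_cast hD
  have hlog : 0 ≤ Real.log D := Real.log_nonneg h1
  have hs : 1 ≤ Real.sqrt D := by rw [Real.le_sqrt' (by norm_num)]; simpa using h1
  exact Real.one_le_rpow (by nlinarith) (by norm_num)

/-- **`‖L(s, χ)‖ ≤ 41 P_D ‖s‖` for `re s ≥ 11/20`**, `χ` primitive mod `D ≥ 2` (the tree's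
`norm_LFunction_le_rpow_polyaVinogradov` with `δ = 19/40`: `∑ n^{-41/40} ≤ 41`).
[cite: MontgomeryVaughan2007, §9.4 Thm 9.18] -/
theorem norm_LFunction_le_pvFac (hD : 2 ≤ D) (hprim : χ.IsPrimitive) {s : ℂ} (hs : 11 / 20 ≤ s.re) :
    ‖χ.LFunction s‖ ≤ 41 * pvFac D * ‖s‖ := by
  have h := DirichletAbel.norm_LFunction_le_rpow_polyaVinogradov χ hD hprim (δ := 19 / 40)
    (by norm_num) (by norm_num) (s := s) (by linarith) (by linarith)
  have hsum : ∑' n : ℕ, ((n + 1 : ℕ) : ℝ) ^ (-(s.re + 19 / 40)) ≤ 41 := by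
    have hle : ∀ n : ℕ, ((n + 1 : ℕ) : ℝ) ^ (-(s.re + 19 / 40)) ≤ ((n + 1 : ℕ) : ℝ) ^ (-(1 + 1 / 40 : ℝ)) :=
      fun n => Real.rpow_le_rpow_of_exponent_le (by exact_mod_cast Nat.le_add_left 1 n) (by linarith)
    have hs1 : Summable fun n : ℕ => ((n + 1 : ℕ) : ℝ) ^ (-(1 + 1 / 40 : ℝ)) :=
      Zhang2022.Lemma31.summable_succ_rpow_neg (by norm_num)
    have hs0 : Summable fun n : ℕ => ((n + 1 : ℕ) : ℝ) ^ (-(s.re + 19 / 40)) :=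
      Zhang2022.Lemma31.summable_succ_rpow_neg (by linarith)
    calc ∑' n : ℕ, ((n + 1 : ℕ) : ℝ) ^ (-(s.re + 19 / 40))
        ≤ ∑' n : ℕ, ((n + 1 : ℕ) : ℝ) ^ (-(1 + 1 / 40 : ℝ)) := hs0.tsum_le_tsum hle hs1
      _ ≤ 1 + 40 := tsum_succ_rpow_neg_one_add_inv_le (by norm_num)
      _ = 41 := by norm_num
  have hP : 0 ≤ pvFac D := le_trans zero_le_one (one_le_pvFac (by omega))
  calc ‖χ.LFunction s‖ ≤ pvFac D * ‖s‖ * ∑' n : ℕ, ((n + 1 : ℕ) : ℝ) ^ (-(s.re + 19 / 40)) := h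
    _ ≤ pvFac D * ‖s‖ * 41 := by gcongr
    _ = 41 * pvFac D * ‖s‖ := by ring

/-- The constant of the strip bound for `g`: `G_D = 41² · 11 · P_D² d(D)²`. [folklore] -/
def gFac (D : ℕ) : ℝ := 41 ^ 2 * 11 * pvFac D ^ 2 * (D.divisors.card : ℝ) ^ 2

omit [NeZero D] in
/-- `G_D ≥ 1` for `D ≥ 1`. [folklore] -/
private theorem one_le_gFac (hD : D ≠ 0) : 1 ≤ gFac D := by
  unfold gFac
  have hτ1 : (1 : ℝ) ≤ D.divisors.card := by
    exact_mod_cast Finset.card_pos.2 ⟨1, Nat.one_mem_divisors.2 hD⟩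
  have hP := one_le_pvFac (D := D) (Nat.one_le_iff_ne_zero.2 hD)
  have h1 : (1 : ℝ) ≤ pvFac D ^ 2 := one_le_pow₀ hP
  have h2 : (1 : ℝ) ≤ (D.divisors.card : ℝ) ^ 2 := one_le_pow₀ hτ1
  nlinarith

/-- **`g` on `re z ≥ −9/20`** (`χ` primitive mod `D ≥ 2`): `‖g(z)‖ ≤ G_D ‖1 + z‖²`.
[cite: Zhang2022LandauSiegel, §3 (3.3)] -/
theorem norm_gFun_le_deep (hD : 2 ≤ D) (hprim : χ.IsPrimitive) {z : ℂ} (hz : -(9 / 20) ≤ z.re) :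
    ‖gFun χ z‖ ≤ gFac D * ‖1 + z‖ ^ 2 := by
  have hD0 : D ≠ 0 := by omega
  have hre : 11 / 20 ≤ ((1 : ℂ) + z).re := by simp; linarith
  have hL := norm_LFunction_le_pvFac χ hD hprim hre
  have hφ := norm_phi_le_deep' hD0 hre
  have h0 : 0 ≤ ‖χ.LFunction (1 + z)‖ := norm_nonneg _
  rw [gFun, norm_mul, norm_pow]
  calc ‖χ.LFunction (1 + z)‖ ^ 2 * ‖phi D (1 + z)‖
      ≤ (41 * pvFac D * ‖(1 : ℂ) + z‖) ^ 2 * (11 * (D.divisors.card : ℝ) ^ 2) :=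
        mul_le_mul (pow_le_pow_left₀ h0 hL 2) hφ (norm_nonneg _) (by positivity)
    _ = gFac D * ‖(1 : ℂ) + z‖ ^ 2 := by rw [gFac]; ring

/-- `‖g(0)‖ ≤ G_D`. [cite: Zhang2022LandauSiegel, §3 (3.3)] -/
theorem norm_gFun_zero_le_deep (hD : 2 ≤ D) (hprim : χ.IsPrimitive) : ‖gFun χ 0‖ ≤ gFac D := by
  have := norm_gFun_le_deep χ hD hprim (z := 0) (by norm_num)
  simpa using this

end GDeep

/-! ### §3. The numerator on the closed strip `−9/20 ≤ re z ≤ 2` and the shift to `re z = −9/20` -/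

section StripDeep

variable {D : ℕ} [NeZero D] (χ : DirichletCharacter ℂ D) {X₁ X₂ : ℝ}

variable (X₁ X₂) in
/-- `M'_X = X₂^{-9/20} + X₂² + X₁^{-9/20} + X₁²` bounds `X₂^x + X₁^x` for `−9/20 ≤ x ≤ 2`. [folklore] -/
def MXd : ℝ := X₂ ^ (-(9 / 20) : ℝ) + X₂ ^ (2 : ℝ) + (X₁ ^ (-(9 / 20) : ℝ) + X₁ ^ (2 : ℝ))

omit [NeZero D] in
/-- `X^x ≤ X^{-9/20} + X²` for `X > 0`, `−9/20 ≤ x ≤ 2`. [folklore] -/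
private theorem rpow_le_rpow_add_deep {X x : ℝ} (hX : 0 < X) (h1 : -(9 / 20) ≤ x) (h2 : x ≤ 2) :
    X ^ x ≤ X ^ (-(9 / 20) : ℝ) + X ^ (2 : ℝ) := by
  rcases le_or_gt 1 X with hX1 | hX1
  · have := Real.rpow_le_rpow_of_exponent_le hX1 h2
    linarith [Real.rpow_nonneg hX.le (-(9 / 20) : ℝ)]
  · have := Real.rpow_le_rpow_of_exponent_ge hX hX1.le h1
    linarith [Real.rpow_nonneg hX.le (2 : ℝ)]

omit [NeZero D] in
/-- **`ε` in the deep strip**, away from `0`: `‖ε(z)‖ ≤ 4 M'_X` for `−9/20 ≤ re z ≤ 2`, `‖z‖ ≥ 1/4`.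
[folklore] -/
private theorem norm_eps_le_deep (hX₁ : 0 < X₁) (hX₂ : 0 < X₂) {z : ℂ} (h1 : -(9 / 20) ≤ z.re)
    (h2 : z.re ≤ 2) (hz : 1 / 4 ≤ ‖z‖) : ‖eps X₁ X₂ z‖ ≤ 4 * MXd X₁ X₂ := by
  have hz0 : z ≠ 0 := by
    intro h; rw [h, norm_zero] at hz; norm_num at hz
  rw [eps_of_ne_zero _ _ hz0, norm_div]
  have hnum : ‖(X₂ : ℂ) ^ z - (X₁ : ℂ) ^ z‖ ≤ MXd X₁ X₂ := by
    refine (norm_sub_le _ _).trans ?_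
    rw [Complex.norm_cpow_eq_rpow_re_of_pos hX₂, Complex.norm_cpow_eq_rpow_re_of_pos hX₁, MXd]
    exact add_le_add (rpow_le_rpow_add_deep hX₂ h1 h2) (rpow_le_rpow_add_deep hX₁ h1 h2)
  have hM0 : 0 ≤ MXd X₁ X₂ := by unfold MXd; positivity
  rw [div_le_iff₀ (by linarith)]
  nlinarith

variable (X₁ X₂) in
/-- The constant of the deep strip bound for `N`. [folklore] -/
def Kdeep (D : ℕ) : ℝ := 5 ^ 8 * CΓ * (4 * MXd X₁ X₂) * (80 * gFac D)

omit [NeZero D] in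
/-- `K ≥ 0`. [folklore] -/
private theorem Kdeep_nonneg (hX₁ : 0 < X₁) (hX₂ : 0 < X₂) (hD : D ≠ 0) : 0 ≤ Kdeep X₁ X₂ D := by
  unfold Kdeep MXd
  have := CΓ_pos
  have := one_le_gFac (D := D) hD
  positivity

/-- **The numerator in the deep strip**: for `χ` primitive mod `D ≥ 2`, `−9/20 ≤ re z ≤ 2` and
`‖z‖ ≥ 1/4`, `‖N(z)‖ ≤ K (1 + |im z|)¹³ e^{-π|im z|/2}`. [cite: Zhang2022LandauSiegel, §3, proof of
Lemma 3.1] -/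
theorem norm_numer_le_deep (hD : 2 ≤ D) (hprim : χ.IsPrimitive) (hX₁ : 0 < X₁) (hX₂ : 0 < X₂)
    {z : ℂ} (h1 : -(9 / 20) ≤ z.re) (h2 : z.re ≤ 2) (hz : 1 / 4 ≤ ‖z‖) :
    ‖numer χ X₁ X₂ z‖ ≤ Kdeep X₁ X₂ D * ((1 + |z.im|) ^ 13 * Real.exp (-(π * |z.im| / 2))) := by
  have hD0 : D ≠ 0 := by omega
  have hy0 := abs_nonneg z.im
  have hzn : ‖z‖ ≤ 2 + |z.im| := by
    have := Complex.norm_le_abs_re_add_abs_im z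
    have : |z.re| ≤ 2 := abs_le.2 ⟨by linarith, h2⟩
    linarith
  have h1z : ‖(1 : ℂ) + z‖ ≤ 3 * (1 + |z.im|) := by
    have := norm_add_le (1 : ℂ) z
    rw [norm_one] at this
    linarith
  -- ζ₁
  have hζ : ‖riemannZeta₁ (1 + z)‖ ≤ 5 ^ 4 * (1 + |z.im|) ^ 4 := by
    have h := BurnolVectors.norm_riemannZeta₁_le (s := 1 + z) (by simp; linarith)
    refine h.trans ?_
    have : ‖(1 : ℂ) + z‖ + 2 ≤ 5 * (1 + |z.im|) := by linarith
    calc (‖(1 : ℂ) + z‖ + 2) ^ 4 ≤ (5 * (1 + |z.im|)) ^ 4 := by gcongr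
      _ = 5 ^ 4 * (1 + |z.im|) ^ 4 := by ring
  -- Γ
  have hΓ : ‖Complex.Gamma (z + 1)‖ ≤ CΓ * (1 + |z.im|) ^ 3 * Real.exp (-(π * |z.im| / 2)) := by
    have := norm_Gamma_strip_le (x := z.re + 1) (by linarith) (by linarith) z.im
    have e : ((z.re + 1 : ℝ) : ℂ) + z.im * I = z + 1 := by
      rw [show ((z.re + 1 : ℝ) : ℂ) = (z.re : ℂ) + 1 by push_cast; ring]
      conv_rhs => rw [← Complex.re_add_im z]
      ring
    rwa [e] at this
  -- ε
  have hε := norm_eps_le_deep (X₁ := X₁) (X₂ := X₂) hX₁ hX₂ h1 h2 hz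
  -- dslope g 0
  have hz0 : z ≠ 0 := by
    intro h; rw [h, norm_zero] at hz; norm_num at hz
  have hG1 := one_le_gFac (D := D) hD0
  have hG0 : 0 ≤ gFac D := by linarith
  have hg : ‖gFun χ z‖ ≤ gFac D * (9 * (1 + |z.im|) ^ 2) := by
    refine (norm_gFun_le_deep χ hD hprim h1).trans ?_
    have h3 : ‖(1 : ℂ) + z‖ ^ 2 ≤ (3 * (1 + |z.im|)) ^ 2 := pow_le_pow_left₀ (norm_nonneg _) h1z 2
    calc gFac D * ‖(1 : ℂ) + z‖ ^ 2 ≤ gFac D * (3 * (1 + |z.im|)) ^ 2 := by gcongr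
      _ = _ := by ring
  have hg0 : ‖gFun χ 0‖ ≤ gFac D * (9 * (1 + |z.im|) ^ 2) := by
    refine (norm_gFun_zero_le_deep χ hD hprim).trans ?_
    have h19 : (1 : ℝ) ≤ 9 * (1 + |z.im|) ^ 2 := by nlinarith
    calc gFac D = gFac D * 1 := by ring
      _ ≤ _ := by gcongr
  have hq : ‖dslope (gFun χ) 0 z‖ ≤ 80 * gFac D * (1 + |z.im|) ^ 2 := by
    rw [dslope_of_ne _ hz0, slope_def_field, sub_zero, norm_div, div_le_iff₀ (by linarith)]
    have := norm_sub_le (gFun χ z) (gFun χ 0)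
    nlinarith [norm_nonneg (gFun χ z - gFun χ 0)]
  -- combine
  have hE := Real.exp_pos (-(π * |z.im| / 2))
  have hMX : 0 ≤ MXd X₁ X₂ := by unfold MXd; positivity
  have hC := CΓ_pos
  rw [numer, norm_mul, norm_mul, norm_mul, norm_pow]
  calc ‖riemannZeta₁ (1 + z)‖ ^ 2 * ‖Complex.Gamma (z + 1)‖ * ‖eps X₁ X₂ z‖ * ‖dslope (gFun χ) 0 z‖
      ≤ (5 ^ 4 * (1 + |z.im|) ^ 4) ^ 2 * (CΓ * (1 + |z.im|) ^ 3 * Real.exp (-(π * |z.im| / 2))) *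
          (4 * MXd X₁ X₂) * (80 * gFac D * (1 + |z.im|) ^ 2) := by
        gcongr
    _ = Kdeep X₁ X₂ D * ((1 + |z.im|) ^ 13 * Real.exp (-(π * |z.im| / 2))) := by
        rw [Kdeep]; ring

/-- Integrability of `N(c+iy)/(c+iy)` on the lines `−9/20 ≤ c ≤ 2`, `|c| ≥ 1/4` (the vertical sides
of the contour shift). [cite: Zhang2022LandauSiegel, §3, proof of Lemma 3.1] -/
theorem integrable_numer_div_line_deep (hD : 2 ≤ D) (hprim : χ.IsPrimitive) (hX₁ : 0 < X₁)
    (hX₂ : 0 < X₂) {c : ℝ} (hc1 : -(9 / 20) ≤ c) (hc2 : c ≤ 2) (hca : 1 / 4 ≤ |c|) :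
    Integrable fun y : ℝ => numer χ X₁ X₂ (c + y * I) / ((c : ℂ) + y * I - 0) := by
  have hD0 : D ≠ 0 := by omega
  have hχ1 : χ ≠ 1 := ne_one_of_isPrimitive χ hD hprim
  have hc0 : c ≠ 0 := by intro h; rw [h] at hca; norm_num at hca
  set K : ℝ := Kdeep X₁ X₂ D with hK
  have hK0 : 0 ≤ K := Kdeep_nonneg hX₁ hX₂ hD0
  have hcont := continuous_numer_div_line χ hχ1 hX₁ hX₂ (c := c) (by linarith) hc0
  refine (((integrable_pow_mul_exp 13).const_mul (K * 4)).mono' hcont.aestronglyMeasurable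
    (Eventually.of_forall fun y => ?_))
  rw [sub_zero, norm_div]
  have hw : 1 / 4 ≤ ‖((c : ℂ) + y * I)‖ := by
    have hre : (((c : ℂ) + y * I)).re = c := by simp
    have := abs_re_le_norm (((c : ℂ) + y * I))
    rw [hre] at this
    exact hca.trans this
  have him : (((c : ℂ) + y * I)).im = y := by simp
  have hb := norm_numer_le_deep χ hD hprim hX₁ hX₂ (z := ((c : ℂ) + y * I)) (by simpa using hc1)
    (by simpa using hc2) hw
  rw [← hK, him] at hb
  rw [div_le_iff₀ (by linarith)]
  calc ‖numer χ X₁ X₂ ((c : ℂ) + y * I)‖ ≤ K * ((1 + |y|) ^ 13 * Real.exp (-(π * |y| / 2))) := hb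
    _ = K * 4 * ((1 + |y|) ^ 13 * Real.exp (-(π * |y| / 2))) * (1 / 4) := by ring
    _ ≤ K * 4 * ((1 + |y|) ^ 13 * Real.exp (-(π * |y| / 2))) * ‖((c : ℂ) + y * I)‖ := by
        gcongr

/-- Horizontal decay of `N(z)/z` in the strip `−9/20 ≤ re z ≤ 2` (the horizontal sides of the
contour shift). [cite: Zhang2022LandauSiegel, §3, proof of Lemma 3.1] -/
theorem numer_horizontal_decay_deep (hD : 2 ≤ D) (hprim : χ.IsPrimitive) (hX₁ : 0 < X₁)
    (hX₂ : 0 < X₂) (ε : ℝ) (hε : 0 < ε) :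
    ∃ T₀ : ℝ, ∀ σ ∈ Icc (-(9 / 20) : ℝ) 2, ∀ T : ℝ, T₀ ≤ |T| →
      ‖numer χ X₁ X₂ (σ + T * I) / (σ + T * I - 0)‖ ≤ ε := by
  have hD0 : D ≠ 0 := by omega
  set K : ℝ := Kdeep X₁ X₂ D with hK
  have hK0 : 0 ≤ K := Kdeep_nonneg hX₁ hX₂ hD0
  obtain ⟨T₁, hT₁⟩ := exists_pow_mul_exp_le 13 hK0 hε
  refine ⟨max T₁ 1, fun σ hσ T hT => ?_⟩
  have hTT : T₁ ≤ |T| := le_trans (le_max_left _ _) hT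
  have hT1 : 1 ≤ |T| := le_trans (le_max_right _ _) hT
  set w : ℂ := (σ : ℂ) + T * I with hw
  have hwim : w.im = T := by simp [hw]
  have hwre : w.re = σ := by simp [hw]
  have hwn : 1 ≤ ‖w‖ := by
    have := abs_im_le_norm w; rw [hwim] at this; linarith
  have hb := norm_numer_le_deep χ hD hprim hX₁ hX₂ (z := w) (by rw [hwre]; exact hσ.1)
    (by rw [hwre]; exact hσ.2) (by linarith)
  rw [← hK, hwim] at hb
  rw [sub_zero, norm_div]
  calc ‖numer χ X₁ X₂ w‖ / ‖w‖ ≤ ‖numer χ X₁ X₂ w‖ := div_le_self (norm_nonneg _) hwn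
    _ ≤ K * ((1 + |T|) ^ 13 * Real.exp (-(π * |T| / 2))) := hb
    _ ≤ ε := hT₁ T hTT

/-- **The shift from `re z = 2` to `re z = −9/20`** across the simple pole of `N(z)/z` at `z = 0`:
`∫ N(2+iy)/(2+iy) dy − ∫ N(−9/20+iy)/(−9/20+iy) dy = 2π (log X₂ − log X₁) g′(0)`.
[cite: Zhang2022LandauSiegel, §3, proof of Lemma 3.1] -/
theorem integral_numer_shift_deep (hD : 2 ≤ D) (hprim : χ.IsPrimitive) (hX₁ : 0 < X₁) (hX₂ : 0 < X₂) :
    (∫ y : ℝ, numer χ X₁ X₂ (2 + y * I) / (2 + y * I - 0)) -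
      (∫ y : ℝ, numer χ X₁ X₂ ((-(9 / 20) : ℝ) + y * I) / (((-(9 / 20) : ℝ) : ℂ) + y * I - 0)) =
      2 * π * ((Real.log X₂ - Real.log X₁) * deriv (gFun χ) 0) := by
  have hχ1 : χ ≠ 1 := ne_one_of_isPrimitive χ hD hprim
  have hIa := integrable_numer_div_line_deep χ hD hprim hX₁ hX₂ (c := -(9 / 20)) le_rfl
    (by norm_num) (by rw [abs_of_neg (by norm_num)]; norm_num)
  have hIb := integrable_numer_div_line_deep χ hD hprim hX₁ hX₂ (c := 2) (by norm_num) le_rfl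
    (by rw [abs_of_pos (by norm_num)]; norm_num)
  have hshift := integral_vertical_sub_eq_of_pole (numer χ X₁ X₂) 0 (a := -(9 / 20)) (b := 2)
    (by simp) (by simp) ((differentiableOn_numer χ hχ1 hX₁ hX₂).mono fun w hw => by
      simp only [mem_setOf_eq]; have := hw.1.1; linarith)
    hIa (by simpa using hIb) (numer_horizontal_decay_deep χ hD hprim hX₁ hX₂)
  rw [numer_zero χ hX₁ hX₂] at hshift
  simpa using hshift

/-- **Explicit formula with the remainder on `re z = −9/20`** (`χ` primitive quadratic mod `D ≥ 2`,
`0 < X₁`, `0 < X₂`): `W_{ν²}(X₂) − W_{ν²}(X₁) = g(0)(W_d(X₂) − W_d(X₁)) + (log X₂ − log X₁) g′(0)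
+ (1/2π) ∫ N(−9/20+iy)/(−9/20+iy) dy`. [cite: Zhang2022LandauSiegel, §3, proof of Lemma 3.1] -/
theorem explicit_formula_deep (hD : 2 ≤ D) (hprim : χ.IsPrimitive) (hχ : χ ^ 2 = 1) (hX₁ : 0 < X₁)
    (hX₂ : 0 < X₂) :
    W (fun n => divisorSumChar χ n ^ 2) X₂ - W (fun n => divisorSumChar χ n ^ 2) X₁ =
      gFun χ 0 * (W dCoeff X₂ - W dCoeff X₁) +
      (Real.log X₂ - Real.log X₁) * deriv (gFun χ) 0 +
      (1 / (2 * π)) * ∫ y : ℝ, numer χ X₁ X₂ ((-(9 / 20) : ℝ) + y * I) /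
        (((-(9 / 20) : ℝ) : ℂ) + y * I - 0) := by
  have hshift := integral_numer_shift_deep χ hD hprim hX₁ hX₂
  obtain ⟨-, h2⟩ := integral_numer_line_two χ hχ hX₁ hX₂
  rw [h2] at hshift
  have hπ : (π : ℂ) ≠ 0 := ofReal_ne_zero.2 Real.pi_pos.ne'
  field_simp
  linear_combination hshift

end StripDeep

/-! ### §4. The integral on the line `re z = −9/20` -/

section LineDeep

variable {D : ℕ} [NeZero D] (χ : DirichletCharacter ℂ D)

/-- The absolute constant of the deep line bound. [folklore] -/
def KlineDeep : ℝ := 5 ^ 8 * 120 * CΓ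

omit [NeZero D] in
/-- `KlineDeep > 0`. [folklore] -/
private theorem KlineDeep_pos : 0 < KlineDeep := by unfold KlineDeep; have := CΓ_pos; positivity

/-- **The numerator on the line `re z = −9/20`** (`χ` primitive mod `D ≥ 2`, `0 < A`, `0 < B`):
`‖N(−9/20+iy)‖ ≤ K G_D (A^{-9/20} + B^{-9/20}) (1+|y|)¹³ e^{-π|y|/2}`.
[cite: Zhang2022LandauSiegel, §3, proof of Lemma 3.1] -/
theorem norm_numer_line_deep (hD : 2 ≤ D) (hprim : χ.IsPrimitive) {A B : ℝ} (hA : 0 < A)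
    (hB : 0 < B) (y : ℝ) :
    ‖numer χ A B (((-(9 / 20) : ℝ) : ℂ) + y * I)‖ ≤
      KlineDeep * gFac D * (A ^ (-(9 / 20) : ℝ) + B ^ (-(9 / 20) : ℝ)) *
        ((1 + |y|) ^ 13 * Real.exp (-(π * |y| / 2))) := by
  have hD0 : D ≠ 0 := by omega
  generalize hzdef : (((-(9 / 20) : ℝ) : ℂ) + y * I) = z
  have hzre : z.re = -(9 / 20) := by rw [← hzdef]; simp
  have hzim : z.im = y := by rw [← hzdef]; simp
  have hy0 := abs_nonneg y
  have hz : 9 / 20 ≤ ‖z‖ := by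
    have := Complex.abs_re_le_norm z
    rw [hzre, abs_neg, abs_of_pos (by norm_num : (0:ℝ) < 9 / 20)] at this
    exact this
  have hz0 : z ≠ 0 := by
    intro h; rw [h, norm_zero] at hz; norm_num at hz
  have hzn : ‖z‖ ≤ 9 / 20 + |y| := by
    have := Complex.norm_le_abs_re_add_abs_im z
    rw [hzre, hzim, abs_neg, abs_of_pos (by norm_num : (0:ℝ) < 9 / 20)] at this
    exact this
  have h1z : ‖(1 : ℂ) + z‖ ≤ 3 * (1 + |y|) := by
    have := norm_add_le (1 : ℂ) z
    rw [norm_one] at this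
    linarith
  -- ζ₁
  have hζ : ‖riemannZeta₁ (1 + z)‖ ≤ 5 ^ 4 * (1 + |y|) ^ 4 := by
    have h := BurnolVectors.norm_riemannZeta₁_le (s := 1 + z) (by rw [add_re, one_re, hzre]; norm_num)
    refine h.trans ?_
    have : ‖(1 : ℂ) + z‖ + 2 ≤ 5 * (1 + |y|) := by linarith
    calc (‖(1 : ℂ) + z‖ + 2) ^ 4 ≤ (5 * (1 + |y|)) ^ 4 := by gcongr
      _ = 5 ^ 4 * (1 + |y|) ^ 4 := by ring
  have hζ2 : ‖riemannZeta₁ (1 + z)‖ ^ 2 ≤ 5 ^ 8 * (1 + |y|) ^ 8 := by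
    calc ‖riemannZeta₁ (1 + z)‖ ^ 2 ≤ (5 ^ 4 * (1 + |y|) ^ 4) ^ 2 := pow_le_pow_left₀ (norm_nonneg _) hζ 2
      _ = 5 ^ 8 * (1 + |y|) ^ 8 := by ring
  -- Γ
  have hΓ : ‖Complex.Gamma (z + 1)‖ ≤ CΓ * (1 + |y|) ^ 3 * Real.exp (-(π * |y| / 2)) := by
    have := norm_Gamma_strip_le (x := z.re + 1) (by rw [hzre]; norm_num) (by rw [hzre]; norm_num) z.im
    have e : ((z.re + 1 : ℝ) : ℂ) + z.im * I = z + 1 := by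
      rw [show ((z.re + 1 : ℝ) : ℂ) = (z.re : ℂ) + 1 by push_cast; ring]
      conv_rhs => rw [← Complex.re_add_im z]
      ring
    rwa [e, hzim] at this
  -- ε
  have hε : ‖eps A B z‖ ≤ 3 * (A ^ (-(9 / 20) : ℝ) + B ^ (-(9 / 20) : ℝ)) := by
    rw [eps_of_ne_zero _ _ hz0, norm_div, div_le_iff₀ (by linarith)]
    have hnum : ‖(B : ℂ) ^ z - (A : ℂ) ^ z‖ ≤ A ^ (-(9 / 20) : ℝ) + B ^ (-(9 / 20) : ℝ) := by
      refine (norm_sub_le _ _).trans ?_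
      rw [Complex.norm_cpow_eq_rpow_re_of_pos hB, Complex.norm_cpow_eq_rpow_re_of_pos hA, hzre]
      linarith
    have h0 : 0 ≤ A ^ (-(9 / 20) : ℝ) + B ^ (-(9 / 20) : ℝ) := by positivity
    nlinarith
  -- dslope g 0
  have hG1 := one_le_gFac (D := D) hD0
  set T : ℝ := gFac D * (1 + |y|) ^ 2 with hT
  have hT1 : 1 ≤ T := by
    have h4 : (1 : ℝ) ≤ (1 + |y|) ^ 2 := one_le_pow₀ (by linarith)
    calc (1 : ℝ) = 1 * 1 := by ring
      _ ≤ T := by rw [hT]; exact mul_le_mul hG1 h4 (by norm_num) (by linarith)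
  have hg : ‖gFun χ z‖ ≤ 9 * T := by
    have := norm_gFun_le_deep χ hD hprim (z := z) (by rw [hzre])
    have h3 : ‖(1 : ℂ) + z‖ ^ 2 ≤ (3 * (1 + |y|)) ^ 2 := pow_le_pow_left₀ (norm_nonneg _) h1z 2
    calc ‖gFun χ z‖ ≤ gFac D * ‖(1 : ℂ) + z‖ ^ 2 := this
      _ ≤ gFac D * (3 * (1 + |y|)) ^ 2 := by gcongr
      _ = 9 * T := by rw [hT]; ring
  have hg0 : ‖gFun χ 0‖ ≤ T := by
    have := norm_gFun_zero_le_deep χ hD hprim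
    have h4 : (1 : ℝ) ≤ (1 + |y|) ^ 2 := one_le_pow₀ (by linarith)
    calc ‖gFun χ 0‖ ≤ gFac D * 1 := by simpa using this
      _ ≤ T := by rw [hT]; gcongr
  have hq : ‖dslope (gFun χ) 0 z‖ ≤ 40 * T := by
    rw [dslope_of_ne _ hz0, slope_def_field, sub_zero, norm_div, div_le_iff₀ (by linarith)]
    have := norm_sub_le (gFun χ z) (gFun χ 0)
    nlinarith [norm_nonneg (gFun χ z - gFun χ 0)]
  -- combine
  have hE := Real.exp_pos (-(π * |y| / 2))
  have hC := CΓ_pos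
  have hAB0 : 0 ≤ A ^ (-(9 / 20) : ℝ) + B ^ (-(9 / 20) : ℝ) := by positivity
  have hT0 : 0 ≤ T := by linarith
  have s1 : ‖riemannZeta₁ (1 + z)‖ ^ 2 * ‖Complex.Gamma (z + 1)‖ ≤
      (5 ^ 8 * (1 + |y|) ^ 8) * (CΓ * (1 + |y|) ^ 3 * Real.exp (-(π * |y| / 2))) :=
    mul_le_mul hζ2 hΓ (norm_nonneg _) (by positivity)
  have s2 : ‖riemannZeta₁ (1 + z)‖ ^ 2 * ‖Complex.Gamma (z + 1)‖ * ‖eps A B z‖ ≤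
      (5 ^ 8 * (1 + |y|) ^ 8) * (CΓ * (1 + |y|) ^ 3 * Real.exp (-(π * |y| / 2))) *
        (3 * (A ^ (-(9 / 20) : ℝ) + B ^ (-(9 / 20) : ℝ))) :=
    mul_le_mul s1 hε (norm_nonneg _) (by positivity)
  have s3 : ‖riemannZeta₁ (1 + z)‖ ^ 2 * ‖Complex.Gamma (z + 1)‖ * ‖eps A B z‖ *
      ‖dslope (gFun χ) 0 z‖ ≤
      (5 ^ 8 * (1 + |y|) ^ 8) * (CΓ * (1 + |y|) ^ 3 * Real.exp (-(π * |y| / 2))) *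
        (3 * (A ^ (-(9 / 20) : ℝ) + B ^ (-(9 / 20) : ℝ))) * (40 * T) :=
    mul_le_mul s2 hq (norm_nonneg _) (by positivity)
  rw [numer, norm_mul, norm_mul, norm_mul, norm_pow]
  refine s3.trans (le_of_eq ?_)
  rw [hT, KlineDeep]; ring

/-- **The integral on the line `re z = −9/20`**:
`‖∫ N(−9/20+iy)/(−9/20+iy) dy‖ ≤ 8 · 28¹³ · K G_D (A^{-9/20} + B^{-9/20})`.
[cite: Zhang2022LandauSiegel, §3, proof of Lemma 3.1] -/
theorem norm_integral_line_deep (hD : 2 ≤ D) (hprim : χ.IsPrimitive) {A B : ℝ} (hA : 0 < A)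
    (hB : 0 < B) :
    ‖∫ y : ℝ, numer χ A B ((-(9 / 20) : ℝ) + y * I) / (((-(9 / 20) : ℝ) : ℂ) + y * I - 0)‖ ≤
      8 * 28 ^ 13 * (KlineDeep * gFac D * (A ^ (-(9 / 20) : ℝ) + B ^ (-(9 / 20) : ℝ))) := by
  set K : ℝ := KlineDeep * gFac D * (A ^ (-(9 / 20) : ℝ) + B ^ (-(9 / 20) : ℝ)) with hK
  have hD0 : D ≠ 0 := by omega
  have hK0 : 0 ≤ K := by
    rw [hK]; have := KlineDeep_pos; have := one_le_gFac (D := D) hD0; positivity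
  have hbound : ∀ y : ℝ,
      ‖numer χ A B ((-(9 / 20) : ℝ) + y * I) / (((-(9 / 20) : ℝ) : ℂ) + y * I - 0)‖ ≤
        4 * K * ((1 + |y|) ^ 13 * Real.exp (-(π * |y| / 2))) := by
    intro y
    have hb := norm_numer_line_deep χ hD hprim hA hB y
    rw [← hK] at hb
    rw [sub_zero, norm_div]
    have hw : 1 / 4 ≤ ‖(((-(9 / 20) : ℝ) : ℂ) + y * I)‖ := by
      have hre : ((((-(9 / 20) : ℝ) : ℂ) + y * I)).re = -(9 / 20) := by simp
      have := abs_re_le_norm ((((-(9 / 20) : ℝ) : ℂ) + y * I))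
      rw [hre, abs_neg, abs_of_pos (by norm_num : (0 : ℝ) < 9 / 20)] at this
      linarith
    rw [div_le_iff₀ (by linarith)]
    calc ‖numer χ A B ((-(9 / 20) : ℝ) + y * I)‖ ≤ K * ((1 + |y|) ^ 13 * Real.exp (-(π * |y| / 2))) := hb
      _ = 4 * K * ((1 + |y|) ^ 13 * Real.exp (-(π * |y| / 2))) * (1 / 4) := by ring
      _ ≤ 4 * K * ((1 + |y|) ^ 13 * Real.exp (-(π * |y| / 2))) *
          ‖(((-(9 / 20) : ℝ) : ℂ) + y * I)‖ := by gcongr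
  have hint := (integrable_pow_mul_exp 13).const_mul (4 * K)
  calc ‖∫ y : ℝ, numer χ A B ((-(9 / 20) : ℝ) + y * I) / (((-(9 / 20) : ℝ) : ℂ) + y * I - 0)‖
      ≤ ∫ y : ℝ, 4 * K * ((1 + |y|) ^ 13 * Real.exp (-(π * |y| / 2))) :=
        norm_integral_le_of_norm_le hint (Eventually.of_forall hbound)
    _ = 4 * K * ∫ y : ℝ, (1 + |y|) ^ 13 * Real.exp (-(π * |y| / 2)) := integral_const_mul _ _
    _ ≤ 4 * K * (2 * (2 * (13 : ℕ) + 2) ^ 13) := by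
        gcongr; exact integral_pow_mul_exp_le 13
    _ = 8 * 28 ^ 13 * K := by norm_num; ring

end LineDeep

/-! ### §5. `G_q ≪ √q` and the remainder bound -/

section Final

/-- **`G_q ≤ C √q`**: `G_q = 41²·11·(√q(1+log q))^{19/20} d(q)²` and `d(q)² (1 + log q) ≪ q^{1/40}`
(divisor bound `d(q) ≤ C₀ q^{1/160}`, `log q ≤ 80 q^{1/80}`). [folklore] -/
private theorem exists_gFac_le_sqrt : ∃ C : ℝ, 0 < C ∧ ∀ q : ℕ, q ≠ 0 → gFac q ≤ C * Real.sqrt q := by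
  obtain ⟨C₀, hC₀, hd⟩ := Sieve.exists_card_divisors_le_mul_rpow (by norm_num : (0 : ℝ) < 1 / 160)
  refine ⟨41 ^ 2 * 11 * 81 * C₀ ^ 2, by positivity, fun q hq => ?_⟩
  have hq1 : (1 : ℝ) ≤ q := by exact_mod_cast Nat.one_le_iff_ne_zero.2 hq
  have hq0 : (0 : ℝ) < q := by linarith
  have hlog0 : 0 ≤ Real.log q := Real.log_nonneg hq1
  -- `d(q)² ≤ C₀² q^{1/80}`
  have hdq : (q.divisors.card : ℝ) ^ 2 ≤ C₀ ^ 2 * (q : ℝ) ^ (1 / 80 : ℝ) := by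
    have h := hd q hq
    have h0 : (0 : ℝ) ≤ q.divisors.card := Nat.cast_nonneg _
    calc (q.divisors.card : ℝ) ^ 2 ≤ (C₀ * (q : ℝ) ^ (1 / 160 : ℝ)) ^ 2 := pow_le_pow_left₀ h0 h 2
      _ = C₀ ^ 2 * ((q : ℝ) ^ (1 / 160 : ℝ)) ^ 2 := by ring
      _ = C₀ ^ 2 * (q : ℝ) ^ (1 / 80 : ℝ) := by
          rw [← Real.rpow_natCast ((q : ℝ) ^ (1 / 160 : ℝ)) 2, ← Real.rpow_mul hq0.le]; norm_num
  -- `1 + log q ≤ 81 q^{1/80}`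
  have hlq : 1 + Real.log q ≤ 81 * (q : ℝ) ^ (1 / 80 : ℝ) := by
    have h1 : Real.log q ≤ (q : ℝ) ^ (1 / 80 : ℝ) / (1 / 80) :=
      Real.log_le_rpow_div hq0.le (by norm_num)
    have h2 : (1 : ℝ) ≤ (q : ℝ) ^ (1 / 80 : ℝ) := Real.one_le_rpow hq1 (by norm_num)
    linarith
  -- `P_q² = (√q)^{19/20} (1+log q)^{19/20} ≤ q^{19/40} (1 + log q)`
  have hP : pvFac q ^ 2 ≤ (q : ℝ) ^ (19 / 40 : ℝ) * (1 + Real.log q) := by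
    unfold pvFac
    have hs0 : 0 ≤ Real.sqrt q := Real.sqrt_nonneg _
    have hl1 : 1 ≤ 1 + Real.log q := by linarith
    rw [← Real.rpow_natCast ((Real.sqrt q * (1 + Real.log q)) ^ (19 / 40 : ℝ)) 2,
      ← Real.rpow_mul (by positivity)]
    norm_num
    rw [Real.mul_rpow hs0 (by linarith), Real.sqrt_eq_rpow, ← Real.rpow_mul hq0.le]
    norm_num
    refine mul_le_mul_of_nonneg_left ?_ (by positivity)
    calc (1 + Real.log q) ^ (19 / 20 : ℝ) ≤ (1 + Real.log q) ^ (1 : ℝ) :=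
          Real.rpow_le_rpow_of_exponent_le hl1 (by norm_num)
      _ = 1 + Real.log q := Real.rpow_one _
  -- assemble
  have hq80 : 0 ≤ (q : ℝ) ^ (1 / 80 : ℝ) := Real.rpow_nonneg hq0.le _
  have hmain : (q : ℝ) ^ (19 / 40 : ℝ) * (1 + Real.log q) * (q.divisors.card : ℝ) ^ 2 ≤
      81 * C₀ ^ 2 * Real.sqrt q := by
    calc (q : ℝ) ^ (19 / 40 : ℝ) * (1 + Real.log q) * (q.divisors.card : ℝ) ^ 2
        ≤ (q : ℝ) ^ (19 / 40 : ℝ) * (81 * (q : ℝ) ^ (1 / 80 : ℝ)) * (C₀ ^ 2 * (q : ℝ) ^ (1 / 80 : ℝ)) := by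
          gcongr
      _ = 81 * C₀ ^ 2 * ((q : ℝ) ^ (19 / 40 : ℝ) * (q : ℝ) ^ (1 / 80 : ℝ) * (q : ℝ) ^ (1 / 80 : ℝ)) := by
          ring
      _ = 81 * C₀ ^ 2 * Real.sqrt q := by
          rw [← Real.rpow_add hq0, ← Real.rpow_add hq0, Real.sqrt_eq_rpow]; norm_num
  unfold gFac
  have h0 : 0 ≤ (q.divisors.card : ℝ) ^ 2 := sq_nonneg _
  calc 41 ^ 2 * 11 * pvFac q ^ 2 * (q.divisors.card : ℝ) ^ 2
      ≤ 41 ^ 2 * 11 * ((q : ℝ) ^ (19 / 40 : ℝ) * (1 + Real.log q)) * (q.divisors.card : ℝ) ^ 2 := by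
        gcongr
    _ = 41 ^ 2 * 11 * ((q : ℝ) ^ (19 / 40 : ℝ) * (1 + Real.log q) * (q.divisors.card : ℝ) ^ 2) := by
        ring
    _ ≤ 41 ^ 2 * 11 * (81 * C₀ ^ 2 * Real.sqrt q) := by gcongr
    _ = 41 ^ 2 * 11 * 81 * C₀ ^ 2 * Real.sqrt q := by ring

/-- **The remainder of the explicit formula** (stub S3 of SKELETON I6c, registered signature): for
`χ` primitive quadratic mod `q > 4` and `1 ≤ A ≤ B`,
`‖(W_{ν²}(B) − W_{ν²}(A)) − g(0)(W_d(B) − W_d(A)) − (log B − log A) g′(0)‖ ≤ C √q A^{-9/20}`.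
[cite: ConreyIwaniec2002, §6 (6.48); Zhang2022LandauSiegel, §3, proof of Lemma 3.1] -/
theorem explicit_formula_remainder_le :
    ∃ C : ℝ, 0 < C ∧ ∀ (q : ℕ) [NeZero q], 4 < q → ∀ χ : DirichletCharacter ℂ q,
      χ.IsPrimitive → χ ^ 2 = 1 → ∀ A B : ℝ, 1 ≤ A → A ≤ B →
        ‖(W (fun n => divisorSumChar χ n ^ 2) B - W (fun n => divisorSumChar χ n ^ 2) A) -
            gFun χ 0 * (W dCoeff B - W dCoeff A) -
            (Real.log B - Real.log A) * deriv (gFun χ) 0‖ ≤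
          C * Real.sqrt q * A ^ (-(9 / 20 : ℝ)) := by
  obtain ⟨Cg, hCg, hg⟩ := exists_gFac_le_sqrt
  refine ⟨1 / (2 * π) * (8 * 28 ^ 13 * KlineDeep) * Cg * 2, by have := KlineDeep_pos; positivity,
    fun q _ hq χ hprim hχ A B hA1 hAB => ?_⟩
  have hq2 : 2 ≤ q := by omega
  have hq0 : q ≠ 0 := by omega
  have hA : 0 < A := by linarith
  have hB : 0 < B := by linarith
  have hformula := explicit_formula_deep χ hq2 hprim hχ hA hB
  have hE : (W (fun n => divisorSumChar χ n ^ 2) B - W (fun n => divisorSumChar χ n ^ 2) A) -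
      gFun χ 0 * (W dCoeff B - W dCoeff A) - (Real.log B - Real.log A) * deriv (gFun χ) 0 =
      (1 / (2 * π)) * ∫ y : ℝ, numer χ A B ((-(9 / 20) : ℝ) + y * I) /
        (((-(9 / 20) : ℝ) : ℂ) + y * I - 0) := by
    rw [hformula]; ring
  rw [hE, norm_mul]
  have hnorm : ‖(1 / (2 * π) : ℂ)‖ = 1 / (2 * π) := by
    rw [norm_div, norm_mul, norm_one, Complex.norm_real, Real.norm_of_nonneg Real.pi_pos.le]
    simp
  have hI := norm_integral_line_deep χ hq2 hprim hA hB
  have hAB' : A ^ (-(9 / 20) : ℝ) + B ^ (-(9 / 20) : ℝ) ≤ 2 * A ^ (-(9 / 20) : ℝ) := by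
    have : B ^ (-(9 / 20) : ℝ) ≤ A ^ (-(9 / 20) : ℝ) :=
      Real.rpow_le_rpow_of_nonpos hA hAB (by norm_num)
    linarith
  have hGq := hg q hq0
  have hK := KlineDeep_pos
  have hG0 : 0 ≤ gFac q := le_trans zero_le_one (one_le_gFac (D := q) hq0)
  have hA0 : 0 ≤ A ^ (-(9 / 20) : ℝ) := Real.rpow_nonneg hA.le _
  rw [hnorm]
  calc 1 / (2 * π) * ‖∫ y : ℝ, numer χ A B ((-(9 / 20) : ℝ) + y * I) /
          (((-(9 / 20) : ℝ) : ℂ) + y * I - 0)‖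
      ≤ 1 / (2 * π) * (8 * 28 ^ 13 * (KlineDeep * gFac q * (A ^ (-(9 / 20) : ℝ) + B ^ (-(9 / 20) : ℝ)))) := by
        gcongr
    _ ≤ 1 / (2 * π) * (8 * 28 ^ 13 * (KlineDeep * (Cg * Real.sqrt q) * (2 * A ^ (-(9 / 20) : ℝ)))) := by
        gcongr
    _ = 1 / (2 * π) * (8 * 28 ^ 13 * KlineDeep) * Cg * 2 * Real.sqrt q * A ^ (-(9 / 20) : ℝ) := by
        ring

end Final

end Literature.NumberTheory.LFunctions.DivisorSumCharSq

end
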